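import Literature.MathematicalPhysics.KineticTheory.LinearLangevinGaussian
import HarnessLib

/-!
# The centred Gaussian measure `Z⁻¹ e^{-x♭ᵀBx♭/2} dq dp` on phase space: integrability and second moments

Trunk T-KINETIC (Literature/MathematicalPhysics/KineticTheory). Third decomposition step for the
named fact `Literature.Barriers.AtomisticToContinuum.HarmonicChainBallisticFlux` (provefact
unit), companion of `LinearLangevinGaussian.lean`: for a POSITIVE DEFINITE precision matrix `B`
on the flat coordinates `x♭ ∈ ℝ^{N ⊕ N}` of phase space,

* `exists_pos_mul_dotProduct_le` — a uniform lower bound `x♭ᵀBx♭ ≥ m |x♭|²`, `m > 0` (minimum of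
  the form on the compact unit sphere);
* `integrable_mul_gaussDensity` — every continuous `g` of quartic growth,
  `|g| ≤ K (1 + |x♭|²)²`, is integrable against `ρ_B = e^{-x♭ᵀBx♭/2}` (domination by a product of
  one-dimensional Gaussians `∏ e^{-m x_a²/4}`), in particular `ρ_B ∈ L¹`;
* `gaussMeasure B := volume.tilted (-x♭ᵀBx♭/2)` — the normalised Gaussian probability measure
  `Z⁻¹ ρ_B dq dp` (Mathlib's `Measure.tilted`, as for the Gibbs measure of
  `LangevinChainGibbs.lean`), with `integral_gaussMeasure`, `integrable_gaussMeasure`;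
* `integral_flat_mul_flat_mul_gaussDensity` — **second moments by integration by parts**: if
  `C B = 1` then `∫ x♭_a x♭_b ρ_B = C_{ba} ∫ ρ_B`, i.e. the covariance matrix of `gaussMeasure B`
  is `B⁻¹` (`x♭_b ρ_B = -∑_c C_{bc} ∂_c ρ_B`, then `∫ x♭_a ∂_c ρ_B = -[a = c] ∫ ρ_B`).

These are the standard facts "the Gaussian `∝ e^{-½ xᵀ Σ⁻¹ x}` is a probability density with
covariance `Σ`" (Dhar 2008, §3.1), proved here directly on phase space without Mathlib's
`multivariateGaussian` (which is defined on `EuclideanSpace` as a push-forward and has no density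
API), because the steady-state computation of `LinearLangevinGaussian.lean` is phrased with
Lebesgue densities.

## References

* A. Dhar, Adv. Phys. 57 (2008) 457, §3.1 ("the steady state is given by the Gaussian
  distribution `(2π)^{-N} Det[B]^{-1/2} e^{-½ qᵀ B⁻¹ q}`"). [cite: Dhar2008, §3.1]
-/

noncomputable section

open MeasureTheory Matrix

namespace Literature.MathematicalPhysics.KineticTheory.HeatConduction

variable {N : ℕ}

/-! ### A positive definite form is bounded below by a multiple of `|x|²` -/

/-- On `ι → ℝ`, `v ⬝ v ≤ card(ι) ‖v‖²` for the sup norm. [folklore] -/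
theorem dotProduct_self_le_card_mul_norm_sq {ι : Type*} [Fintype ι] (v : ι → ℝ) :
    v ⬝ᵥ v ≤ Fintype.card ι * ‖v‖ ^ 2 := by
  have h : ∀ a, v a * v a ≤ ‖v‖ ^ 2 := by
    intro a
    have h1 : |v a| ≤ ‖v‖ := by
      have := norm_le_pi_norm v a
      rwa [Real.norm_eq_abs] at this
    have h2 : |v a| ^ 2 ≤ ‖v‖ ^ 2 := pow_le_pow_left₀ (abs_nonneg _) h1 2
    rw [sq_abs] at h2
    nlinarith [h2]
  calc v ⬝ᵥ v = ∑ a, v a * v a := rfl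
    _ ≤ ∑ _a : ι, ‖v‖ ^ 2 := Finset.sum_le_sum fun a _ => h a
    _ = Fintype.card ι * ‖v‖ ^ 2 := by
        rw [Finset.sum_const, Finset.card_univ, nsmul_eq_mul]

/-- **Uniform positivity of a positive definite form**: there is `m > 0` with
`m (v ⬝ v) ≤ v ⬝ (B v)` for all `v` (the minimum of the form on the compact unit sphere of the
sup norm is positive, and `v ⬝ v ≤ card ‖v‖²_∞`). [folklore] -/
theorem exists_pos_mul_dotProduct_le {ι : Type*} [Fintype ι] [DecidableEq ι] {B : Matrix ι ι ℝ}
    (hB : B.PosDef) : ∃ m : ℝ, 0 < m ∧ ∀ v : ι → ℝ, m * (v ⬝ᵥ v) ≤ v ⬝ᵥ (B *ᵥ v) := by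
  rcases isEmpty_or_nonempty ι with hι | hι
  · refine ⟨1, one_pos, fun v => ?_⟩
    have hv : v = 0 := Subsingleton.elim v 0
    simp [hv]
  set Sph : Set (ι → ℝ) := Metric.sphere (0 : ι → ℝ) 1 with hSph
  have hSc : IsCompact Sph := isCompact_sphere 0 1
  have hSne : Sph.Nonempty := NormedSpace.sphere_nonempty.mpr zero_le_one
  have hmemS : ∀ v ∈ Sph, ‖v‖ = 1 := fun v hv => by simpa [hSph] using hv
  set q : (ι → ℝ) → ℝ := fun v => v ⬝ᵥ (B *ᵥ v) with hq
  have hq_cont : Continuous q := by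
    simp only [hq]
    fun_prop
  obtain ⟨v₀, hv₀S, hv₀min⟩ := hSc.exists_isMinOn hSne hq_cont.continuousOn
  have hv₀ne : v₀ ≠ 0 := by
    intro h
    have := hmemS v₀ hv₀S
    rw [h, norm_zero] at this
    exact zero_ne_one this
  have hm₀ : 0 < q v₀ := by
    have := hB.dotProduct_mulVec_pos hv₀ne
    rwa [star_trivial] at this
  have hcard : (0 : ℝ) < Fintype.card ι := by exact_mod_cast Fintype.card_pos
  refine ⟨q v₀ / Fintype.card ι, div_pos hm₀ hcard, fun v => ?_⟩
  by_cases hv : v = 0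
  · subst hv
    simp
  · have hnv : ‖v‖ ≠ 0 := norm_ne_zero_iff.mpr hv
    have hnv' : 0 < ‖v‖ := norm_pos_iff.mpr hv
    have hu : ‖v‖⁻¹ • v ∈ Sph := by simp [hSph, norm_smul, hnv]
    have h1 : q v₀ ≤ q (‖v‖⁻¹ • v) := hv₀min hu
    have h2 : q (‖v‖⁻¹ • v) = (‖v‖⁻¹) ^ 2 * q v := by
      simp only [hq, mulVec_smul, smul_dotProduct, dotProduct_smul, smul_eq_mul]
      ring
    rw [h2] at h1
    -- `q v ≥ q v₀ ‖v‖²`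
    have h3 : q v₀ * ‖v‖ ^ 2 ≤ q v := by
      have h4 : q v₀ * ‖v‖ ^ 2 ≤ (‖v‖⁻¹) ^ 2 * q v * ‖v‖ ^ 2 :=
        mul_le_mul_of_nonneg_right h1 (by positivity)
      have h5 : (‖v‖⁻¹) ^ 2 * q v * ‖v‖ ^ 2 = q v := by
        field_simp
      linarith
    have h6 := dotProduct_self_le_card_mul_norm_sq v
    calc q v₀ / Fintype.card ι * (v ⬝ᵥ v) ≤ q v₀ / Fintype.card ι * (Fintype.card ι * ‖v‖ ^ 2) :=
          mul_le_mul_of_nonneg_left h6 (div_pos hm₀ hcard).le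
      _ = q v₀ * ‖v‖ ^ 2 := by
          field_simp
      _ ≤ q v := h3

/-! ### Integrability against `ρ_B` for positive definite `B` -/

/-- `x♭ ⬝ x♭ = ∑_i q_i² + ∑_i p_i²`. [folklore] -/
theorem flat_dotProduct_flat (x : PhaseSpace N) :
    flat x ⬝ᵥ flat x = (∑ i, x.1 i ^ 2) + ∑ i, x.2 i ^ 2 := by
  simp only [dotProduct, Fintype.sum_sum_type, flat_inl, flat_inr, sq]

/-- `0 ≤ x♭ ⬝ x♭`. [folklore] -/
theorem flat_dotProduct_flat_nonneg (x : PhaseSpace N) : 0 ≤ flat x ⬝ᵥ flat x :=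
  Finset.sum_nonneg fun _ _ => mul_self_nonneg _

/-- A product of one-dimensional Gaussians is integrable on phase space:
`∫ e^{-c (∑ q_i² + ∑ p_i²)} dq dp < ∞` for `c > 0`. [folklore] -/
theorem integrable_exp_neg_mul_flat_dotProduct (N : ℕ) {c : ℝ} (hc : 0 < c) :
    Integrable fun x : PhaseSpace N => Real.exp (-(c * (flat x ⬝ᵥ flat x))) := by
  set g : PhaseSpace N → ℝ := fun x =>
    (∏ i, Real.exp (-c * x.1 i ^ 2)) * ∏ i, Real.exp (-c * x.2 i ^ 2) with hg
  have hq : Integrable (fun q : Fin N → ℝ => ∏ i, Real.exp (-c * q i ^ 2)) := by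
    have := Integrable.fintype_prod (μ := fun _ : Fin N => (volume : Measure ℝ))
      (f := fun _ t => Real.exp (-c * t ^ 2)) (fun _ => integrable_exp_neg_mul_sq hc)
    simpa [volume_pi] using this
  have hgi : Integrable g := by
    have := hq.mul_prod hq
    simpa [hg, Measure.volume_eq_prod] using this
  refine hgi.congr (Filter.Eventually.of_forall fun x => ?_)
  simp only [hg, ← Real.exp_sum, ← Real.exp_add, flat_dotProduct_flat]
  congr 1
  rw [mul_add, neg_add, Finset.mul_sum, Finset.mul_sum, ← Finset.sum_neg_distrib,
    ← Finset.sum_neg_distrib]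
  congr 1 <;> exact Finset.sum_congr rfl fun i _ => by ring

/-- **Polynomial observables are integrable against `ρ_B`** (`B` positive definite): if `g` is
continuous with `|g(x)| ≤ K (1 + |x♭|²)²` then `g ρ_B ∈ L¹(dq dp)` — domination
`ρ_B ≤ e^{-m|x♭|²/2}` and `(1 + |x♭|²)² e^{-m|x♭|²/4} ≤ const`. [folklore] -/
theorem integrable_mul_gaussDensity {B : Matrix (Fin N ⊕ Fin N) (Fin N ⊕ Fin N) ℝ} (hB : B.PosDef)
    {g : PhaseSpace N → ℝ} (hg : Continuous g) {K : ℝ}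
    (hgK : ∀ x, |g x| ≤ K * (1 + flat x ⬝ᵥ flat x) ^ 2) :
    Integrable fun x => g x * gaussDensity B x := by
  obtain ⟨m, hm, hmB⟩ := exists_pos_mul_dotProduct_le hB
  have hK : 0 ≤ K := by
    have h := hgK 0
    have h0 : flat (0 : PhaseSpace N) ⬝ᵥ flat (0 : PhaseSpace N) = 0 := by
      simp [flat_dotProduct_flat]
    rw [h0, add_zero, one_pow, mul_one] at h
    exact (abs_nonneg _).trans h
  have hs : 0 < m / 4 := by positivity
  set A : ℝ := 2 * Real.exp (m / 4) / (m / 4) ^ 2 with hA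
  have hmaj := (integrable_exp_neg_mul_flat_dotProduct N hs).const_mul (K * A)
  refine hmaj.mono' ((hg.mul (continuous_gaussDensity B)).aestronglyMeasurable)
    (Filter.Eventually.of_forall fun x => ?_)
  set t : ℝ := flat x ⬝ᵥ flat x with ht
  have ht0 : 0 ≤ t := flat_dotProduct_flat_nonneg x
  have hρ : 0 < gaussDensity B x := gaussDensity_pos B x
  rw [Real.norm_eq_abs, abs_mul, abs_of_pos hρ]
  -- `ρ_B ≤ e^{-m t/2}`
  have hρle : gaussDensity B x ≤ Real.exp (-(m * t) / 2) := by
    unfold gaussDensity quadForm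
    exact Real.exp_le_exp.mpr (by have := hmB (flat x); rw [← ht] at this; linarith)
  -- `(1+t)² ≤ A e^{m t/4}`
  have hpoly : (1 + t) ^ 2 ≤ A * Real.exp (m / 4 * t) := one_add_sq_le_exp ht0 hs
  have hexp : Real.exp (m / 4 * t) * Real.exp (-(m * t) / 2) = Real.exp (-(m / 4 * t)) := by
    rw [← Real.exp_add]
    congr 1
    ring
  calc |g x| * gaussDensity B x ≤ K * (1 + t) ^ 2 * Real.exp (-(m * t) / 2) :=
        mul_le_mul (hgK x) hρle hρ.le (by positivity)
    _ ≤ K * (A * Real.exp (m / 4 * t)) * Real.exp (-(m * t) / 2) := by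
        apply mul_le_mul_of_nonneg_right _ (Real.exp_pos _).le
        exact mul_le_mul_of_nonneg_left hpoly hK
    _ = K * A * Real.exp (-(m / 4 * t)) := by rw [← hexp]; ring

/-- `ρ_B` is integrable for positive definite `B`. [folklore] -/
theorem integrable_gaussDensity {B : Matrix (Fin N ⊕ Fin N) (Fin N ⊕ Fin N) ℝ} (hB : B.PosDef) :
    Integrable (gaussDensity B : PhaseSpace N → ℝ) := by
  have h := integrable_mul_gaussDensity hB (g := fun _ => (1 : ℝ)) continuous_const (K := 1)
    (fun x => by
      rw [abs_one, one_mul]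
      nlinarith [flat_dotProduct_flat_nonneg x])
  simpa using h

/-- `|x♭_a| ≤ 1 + x♭ ⬝ x♭`. [folklore] -/
theorem abs_flat_le (x : PhaseSpace N) (a : Fin N ⊕ Fin N) : |flat x a| ≤ 1 + flat x ⬝ᵥ flat x := by
  have h1 : flat x a * flat x a ≤ flat x ⬝ᵥ flat x :=
    Finset.single_le_sum (f := fun b => flat x b * flat x b) (fun b _ => mul_self_nonneg _)
      (Finset.mem_univ a)
  nlinarith [abs_mul_abs_self (flat x a), abs_nonneg (flat x a), sq_nonneg (|flat x a| - 1)]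

/-- `|x♭_a x♭_b| ≤ x♭ ⬝ x♭`. [folklore] -/
theorem abs_flat_mul_flat_le (x : PhaseSpace N) (a b : Fin N ⊕ Fin N) :
    |flat x a * flat x b| ≤ 1 + flat x ⬝ᵥ flat x := by
  have ha : flat x a * flat x a ≤ flat x ⬝ᵥ flat x :=
    Finset.single_le_sum (f := fun c => flat x c * flat x c) (fun c _ => mul_self_nonneg _)
      (Finset.mem_univ a)
  have hb : flat x b * flat x b ≤ flat x ⬝ᵥ flat x :=
    Finset.single_le_sum (f := fun c => flat x c * flat x c) (fun c _ => mul_self_nonneg _)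
      (Finset.mem_univ b)
  rw [abs_mul]
  nlinarith [abs_mul_abs_self (flat x a), abs_mul_abs_self (flat x b), abs_nonneg (flat x a),
    abs_nonneg (flat x b), sq_nonneg (|flat x a| - |flat x b|)]

/-- `|(B x♭)_c| ≤ (∑_d |B_{cd}|) (1 + x♭ ⬝ x♭)`. [folklore] -/
theorem abs_mulVec_flat_le (B : Matrix (Fin N ⊕ Fin N) (Fin N ⊕ Fin N) ℝ) (x : PhaseSpace N)
    (c : Fin N ⊕ Fin N) : |(B *ᵥ flat x) c| ≤ (∑ d, |B c d|) * (1 + flat x ⬝ᵥ flat x) := by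
  calc |(B *ᵥ flat x) c| = |∑ d, B c d * flat x d| := rfl
    _ ≤ ∑ d, |B c d * flat x d| := Finset.abs_sum_le_sum_abs _ _
    _ ≤ ∑ d, |B c d| * (1 + flat x ⬝ᵥ flat x) := Finset.sum_le_sum fun d _ => by
        rw [abs_mul]
        exact mul_le_mul_of_nonneg_left (abs_flat_le x d) (abs_nonneg _)
    _ = (∑ d, |B c d|) * (1 + flat x ⬝ᵥ flat x) := by rw [Finset.sum_mul]

/-- `x♭_a ρ_B ∈ L¹`. [folklore] -/
theorem integrable_flat_mul_gaussDensity {B : Matrix (Fin N ⊕ Fin N) (Fin N ⊕ Fin N) ℝ}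
    (hB : B.PosDef) (a : Fin N ⊕ Fin N) :
    Integrable fun x : PhaseSpace N => flat x a * gaussDensity B x := by
  refine integrable_mul_gaussDensity hB (continuous_flat_apply a) (K := 1) fun x => ?_
  have := abs_flat_le x a
  nlinarith [flat_dotProduct_flat_nonneg x]

/-- `x♭_a x♭_b ρ_B ∈ L¹`. [folklore] -/
theorem integrable_flat_mul_flat_mul_gaussDensity {B : Matrix (Fin N ⊕ Fin N) (Fin N ⊕ Fin N) ℝ}
    (hB : B.PosDef) (a b : Fin N ⊕ Fin N) :
    Integrable fun x : PhaseSpace N => flat x a * flat x b * gaussDensity B x := by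
  refine integrable_mul_gaussDensity hB ((continuous_flat_apply a).mul (continuous_flat_apply b))
    (K := 1) fun x => ?_
  have := abs_flat_mul_flat_le x a b
  nlinarith [flat_dotProduct_flat_nonneg x]

/-- `x♭_a (B x♭)_c ρ_B ∈ L¹`. [folklore] -/
theorem integrable_flat_mul_mulVec_flat_mul_gaussDensity
    {B : Matrix (Fin N ⊕ Fin N) (Fin N ⊕ Fin N) ℝ} (hB : B.PosDef) (a c : Fin N ⊕ Fin N) :
    Integrable fun x : PhaseSpace N => flat x a * ((B *ᵥ flat x) c * gaussDensity B x) := by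
  have h : Integrable fun x : PhaseSpace N => (flat x a * (B *ᵥ flat x) c) * gaussDensity B x := by
    refine integrable_mul_gaussDensity hB
      ((continuous_flat_apply a).mul (continuous_mulVec_flat_apply B c)) (K := ∑ d, |B c d|)
      fun x => ?_
    rw [abs_mul]
    have h1 := abs_flat_le x a
    have h2 := abs_mulVec_flat_le B x c
    have h0 : 0 ≤ 1 + flat x ⬝ᵥ flat x := by linarith [flat_dotProduct_flat_nonneg x]
    calc |flat x a| * |(B *ᵥ flat x) c| ≤ (1 + flat x ⬝ᵥ flat x) * ((∑ d, |B c d|) *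
        (1 + flat x ⬝ᵥ flat x)) := mul_le_mul h1 h2 (abs_nonneg _) h0
      _ = (∑ d, |B c d|) * (1 + flat x ⬝ᵥ flat x) ^ 2 := by ring
  refine h.congr (Filter.Eventually.of_forall fun x => ?_)
  simp only
  ring

/-! ### The normalised Gaussian measure -/

/-- The centred Gaussian probability measure `Z⁻¹ e^{-x♭ᵀBx♭/2} dq dp` on phase space with
precision matrix `B` (Lebesgue measure exponentially tilted by `-x♭ᵀBx♭/2`; a probability
measure when `B` is positive definite, the zero measure if `ρ_B ∉ L¹`). [Dhar 2008, §3.1]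
[cite: Dhar2008, §3.1] -/
def gaussMeasure (B : Matrix (Fin N ⊕ Fin N) (Fin N ⊕ Fin N) ℝ) : Measure (PhaseSpace N) :=
  (volume : Measure (PhaseSpace N)).tilted fun x => -(quadForm B x) / 2

variable (B : Matrix (Fin N ⊕ Fin N) (Fin N ⊕ Fin N) ℝ)

/-- The tilting density is `ρ_B`. [folklore] -/
theorem exp_neg_quadForm_div_two (x : PhaseSpace N) :
    Real.exp (-(quadForm B x) / 2) = gaussDensity B x := rfl

/-- `gaussMeasure B ≪ dq dp`. [folklore] -/
theorem gaussMeasure_absolutelyContinuous : gaussMeasure B ≪ (volume : Measure (PhaseSpace N)) :=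
  tilted_absolutelyContinuous _ _

/-- For positive definite `B` the Gaussian measure is a probability measure. [folklore] -/
theorem isProbabilityMeasure_gaussMeasure {B : Matrix (Fin N ⊕ Fin N) (Fin N ⊕ Fin N) ℝ}
    (hB : B.PosDef) : IsProbabilityMeasure (gaussMeasure B) :=
  isProbabilityMeasure_tilted (integrable_gaussDensity hB)

/-- `∫ g d(gaussMeasure B) = (∫ ρ_B)⁻¹ ∫ g ρ_B dq dp`. [folklore] -/
theorem integral_gaussMeasure (g : PhaseSpace N → ℝ) :
    ∫ x, g x ∂(gaussMeasure B) = (∫ x, gaussDensity B x)⁻¹ * ∫ x, g x * gaussDensity B x := by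
  rw [gaussMeasure, integral_tilted, ← integral_const_mul]
  refine integral_congr_ae (Filter.Eventually.of_forall fun x => ?_)
  simp only [smul_eq_mul, exp_neg_quadForm_div_two]
  ring

/-- Integrability against the Gaussian measure from Lebesgue integrability of `g ρ_B`.
[folklore] -/
theorem integrable_gaussMeasure {g : PhaseSpace N → ℝ}
    (hg : Integrable (fun x => g x * gaussDensity B x)) : Integrable g (gaussMeasure B) := by
  by_cases h : Integrable (gaussDensity B : PhaseSpace N → ℝ)
  · rw [gaussMeasure, integrable_tilted_iff h]
    refine hg.congr (Filter.Eventually.of_forall fun x => ?_)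
    simp only [smul_eq_mul, exp_neg_quadForm_div_two]
    ring
  · rw [gaussMeasure, tilted_of_not_integrable h]
    exact integrable_zero_measure

/-- `0 < ∫ ρ_B` for positive definite `B`. [folklore] -/
theorem integral_gaussDensity_pos {B : Matrix (Fin N ⊕ Fin N) (Fin N ⊕ Fin N) ℝ} (hB : B.PosDef) :
    0 < ∫ x : PhaseSpace N, gaussDensity B x :=
  integral_exp_pos (integrable_gaussDensity hB)

/-! ### Second moments by integration by parts -/

/-- A positive definite real matrix is symmetric. [folklore] -/
theorem transpose_eq_of_posDef {ι : Type*} [Fintype ι] {B : Matrix ι ι ℝ} (hB : B.PosDef) :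
    Bᵀ = B := by
  have := hB.isHermitian
  rwa [Matrix.IsHermitian, conjTranspose_eq_transpose_of_trivial] at this

/-- **Gaussian integration by parts (Stein) for a coordinate**:
`∫ x♭_a (B x♭)_c ρ_B = [a = c] ∫ ρ_B`, from `(Bx♭)_c ρ_B = -∂_c ρ_B` and `∂_c x♭_a = [a = c]`.
[folklore] -/
theorem integral_flat_mul_mulVec_flat_mul_gaussDensity
    {B : Matrix (Fin N ⊕ Fin N) (Fin N ⊕ Fin N) ℝ} (hB : B.PosDef) (a c : Fin N ⊕ Fin N) :
    ∫ x : PhaseSpace N, flat x a * ((B *ᵥ flat x) c * gaussDensity B x) =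
      (if a = c then 1 else 0) * ∫ x : PhaseSpace N, gaussDensity B x := by
  haveI := isAddHaarMeasure_volume_phaseSpace N
  have hBt : Bᵀ = B := transpose_eq_of_posDef hB
  have e := integral_bilinear_hasLineDerivAt_right_eq_neg_left_of_integrable
    (μ := (volume : Measure (PhaseSpace N))) (B := ContinuousLinearMap.mul ℝ ℝ)
    (f := fun x : PhaseSpace N => flat x a) (f' := fun _ => if a = c then (1 : ℝ) else 0)
    (g := gaussDensity B) (g' := fun x => -((B *ᵥ flat x) c) * gaussDensity B x)
    (v := coordVec c) ?_ ?_ ?_ (fun x _ => hasLineDerivAt_flat_apply x a c)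
    (fun x _ => hasLineDerivAt_gaussDensity_coordVec B hBt x c)
  · simp only [ContinuousLinearMap.mul_apply'] at e
    have e' : ∫ x : PhaseSpace N, flat x a * (-((B *ᵥ flat x) c) * gaussDensity B x) =
        -((if a = c then 1 else 0) * ∫ x : PhaseSpace N, gaussDensity B x) := by
      rw [e, integral_const_mul]
    rw [← neg_neg ((if a = c then (1:ℝ) else 0) * ∫ x : PhaseSpace N, gaussDensity B x), ← e',
      ← integral_neg]
    refine integral_congr_ae (Filter.Eventually.of_forall fun x => ?_)
    simp only
    ring
  · simp only [ContinuousLinearMap.mul_apply']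
    exact (integrable_gaussDensity hB).const_mul _
  · simp only [ContinuousLinearMap.mul_apply']
    have h := integrable_flat_mul_mulVec_flat_mul_gaussDensity hB a c
    refine (h.neg).congr (Filter.Eventually.of_forall fun x => ?_)
    simp only [Pi.neg_apply]
    ring
  · simp only [ContinuousLinearMap.mul_apply']
    exact integrable_flat_mul_gaussDensity hB a

/-- **Second moments of the Gaussian density**: if `C B = 1` (so `C = B⁻¹`, the covariance) then
`∫ x♭_a x♭_b ρ_B = C_{ba} ∫ ρ_B` (`x♭_b = ∑_c C_{bc} (Bx♭)_c` and the Stein identity).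
[Dhar 2008, §3.1 ("the steady state correlation matrix `B̂` … completely determines the steady
state")] [cite: Dhar2008, §3.1] -/
theorem integral_flat_mul_flat_mul_gaussDensity {B : Matrix (Fin N ⊕ Fin N) (Fin N ⊕ Fin N) ℝ}
    (hB : B.PosDef) {C : Matrix (Fin N ⊕ Fin N) (Fin N ⊕ Fin N) ℝ} (hCB : C * B = 1)
    (a b : Fin N ⊕ Fin N) :
    ∫ x : PhaseSpace N, flat x a * flat x b * gaussDensity B x =
      C b a * ∫ x : PhaseSpace N, gaussDensity B x := by
  -- `x♭_b = ∑_c C_{bc} (B x♭)_c`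
  have hxb : ∀ x : PhaseSpace N, flat x b = ∑ c, C b c * (B *ᵥ flat x) c := by
    intro x
    have := congrFun (mulVec_mulVec (flat x) C B) b
    rw [hCB, one_mulVec] at this
    rw [← this]
    rfl
  have hsplit : (fun x : PhaseSpace N => flat x a * flat x b * gaussDensity B x) =
      fun x => ∑ c, C b c * (flat x a * ((B *ᵥ flat x) c * gaussDensity B x)) := by
    funext x
    rw [hxb x, Finset.mul_sum, Finset.sum_mul]
    exact Finset.sum_congr rfl fun c _ => by ring
  rw [hsplit, integral_finsetSum _ fun c _ =>
    (integrable_flat_mul_mulVec_flat_mul_gaussDensity hB a c).const_mul _]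
  simp_rw [integral_const_mul, integral_flat_mul_mulVec_flat_mul_gaussDensity hB]
  simp only [mul_ite, mul_zero, ite_mul, zero_mul, one_mul]
  rw [Finset.sum_ite_eq]
  simp

/-- **The covariance of the Gaussian measure**: `∫ x♭_a x♭_b d(gaussMeasure B) = C_{ab}` when
`C B = 1` and `C` is symmetric (so `C = B⁻¹`). [Dhar 2008, §3.1] [cite: Dhar2008, §3.1] -/
theorem integral_flat_mul_flat_gaussMeasure {B : Matrix (Fin N ⊕ Fin N) (Fin N ⊕ Fin N) ℝ}
    (hB : B.PosDef) {C : Matrix (Fin N ⊕ Fin N) (Fin N ⊕ Fin N) ℝ} (hCB : C * B = 1)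
    (hC : Cᵀ = C) (a b : Fin N ⊕ Fin N) :
    ∫ x, flat x a * flat x b ∂(gaussMeasure B) = C a b := by
  rw [integral_gaussMeasure, integral_flat_mul_flat_mul_gaussDensity hB hCB, ← mul_assoc,
    mul_comm _ (C b a), mul_assoc, inv_mul_cancel₀ (integral_gaussDensity_pos hB).ne', mul_one]
  have := congrFun (congrFun hC a) b
  rwa [transpose_apply] at this

end Literature.MathematicalPhysics.KineticTheory.HeatConduction
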